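/-
Copyright (c) 2026 the pub-hodgecm-mathlib formalisation cell (harness21).  Prover seat hodgecm-mathlib-F0P3-p02 (g25); (G5) author's JUNCTION TEST for RIDER 2a
«EP-SPLIT» (LH6-p01 (g6) 00:03:03Z: «dischargers consumed by name»); 2026-09-03.
-/
import Summits.HodgeConjecture.HodgeConjecture.Theorems.F0P3cStCharTSEPPseudoCoeffStLetters   -- ★ p853007 (G5) FILE B (this seat): the three dischargers BY NAME
import Summits.HodgeConjecture.HodgeConjecture.Theorems.F0P3cStCharTSEPGlueG                  -- ★ p853021 (G3) (LH10-p02): `exists_epFunction_G` (unramified `v`)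
import Summits.HodgeConjecture.HodgeConjecture.Theorems.F0P3cStCharTSEPGlueGRamified          -- ★ p853075 (G3)-RAM (LH5-p04): `exists_epFunction_G_of_ramified` (tame ramified `v`)
import Summits.HodgeConjecture.HodgeConjecture.Theorems.F0P3cStCharTSEllMassG                  -- ★ p852975 ∕ p853003 (G4): `ellipticWeylMass_G_eq_one_of_epFunction_of_l2CharOnTorusAll`
import Summits.HodgeConjecture.HodgeConjecture.Theorems.F0P3cStCharTSOpp23                     -- ★ OPP-23 (F0P2-p02): `charOpposite_of_PS2`
import HarnessLib

/-!
# F0 · P3c · line LH6 «StCharTS» — CENSUS «EP-G» (G5) «DET-CHAR + PC-ST», FILE C: THE EP-FAMILY LETTERS FROM AN EULER–POINCARÉ FUNCTION, COMPOSED BY NAME — AT AN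
# UNRAMIFIED AND AT A TAMELY RAMIFIED PLACE (K1 at `ψ∘det_G`, K1 ∧ POS-ONE at `St_G(ψ)`, K2′ at `St_G(ψ)` from (G3) ∕ (G3)-RAM + (G4) + (G5) + OPP-23) [Rogawski1990 §12.6 Prop. 12.6.1 (a)(c) pp. 187–188; Kottwitz1988 §2]

Continuation of FILE A `F0P3cStCharTSEPPseudoCoeffSt` (★ p852994) and FILE B `F0P3cStCharTSEPPseudoCoeffStLetters` (★ p853007), same seat F0P3-p02 (g25).  THEOREMS ONLY
(no `def`, no instance, no notation, no named fact, no `sorry`); `𝔇` a BINDER.  PURPOSE: the (G5) author's JUNCTION TEST for RIDER 2a «EP-SPLIT» (rider pen LH6-p01 (g6),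
00:03:03Z: the junction v11 derives the EP-family instances of K1 ∕ K2′ ∕ POS-ONE at UNRAMIFIED `v` from «dischargers consumed by name») — this file composes those names ONCE,
so that the junction body needs one `obtain` per `ψ`:

* §8 **`charOpposite_stG_detG_of_PS2`** — the opposite-character relation `hOpp : ∀ γ ∈ G^e, χ_{St_G(ψ)}(γ) = −χ_{ψ∘det_G}(γ)` for the kind-2 pair, i.e. ★ OPP-23
  `F0P3cStCharTSOpp23.charOpposite_of_PS2` at `(π, σ) := (𝔇.detG ψ, 𝔇.stG ψ)` with the `IsEllipticPair` witness of kind 2 (`rfl`), from `¬ 𝔇.IsL2 (𝔇.detG ψ)`, `𝔇.IsL2 (𝔇.stG ψ)`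
  (the last two clauses of the rung-0 letter `eSt` read through `hC03`) and OPP-23's own binders (COMPAT, `hEΩ`, ELL-OPEN `hopen`, (M1∀), (PS2), (NONL2-PAR)) VERBATIM.
* §9 **`epFamily_letters_of_epFunction`** (PLACE-AGNOSTIC, the Euler–Poincaré function BY SHAPE): from `hEP` = the common conclusion of ★ (G3) `EPGlueG.exists_epFunction_G`
  (unramified `v`) and of (G3)-RAM `EPGlueGRamified.exists_epFunction_G_of_ramified` (tame ramified `v`; same eight clauses token for token):
  `(∃ f, 𝔇.IsPseudoCoeff (𝔇.detG ψ) f) ∧ (∃ f, 𝔇.IsPseudoCoeff (𝔇.stG ψ) f ∧ 0 < (f 1).re ∧ (f 1).im = 0) ∧ 𝔇.innerG (𝔇.char (𝔇.stG ψ)) (𝔇.char (𝔇.stG ψ)) = 1` — `hEP` fed (i) to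
  FILE B §6 (token for token) and (ii) clause by clause to ★ (G4) `ellipticWeylMass_G_eq_one_of_epFunction_of_l2CharOnTorusAll` for `hMass`, then FILE B §7.  Binders: COMPAT
  `hμG horb hreg`, the pin `hE`, (M1∀) `hM1`, the carpet relations `hWIF hC1 hC2 hC3 hL2` (★ (G4)'s, token for token), `hψ : Continuous ψ`, the DET pin `detZ hopen hdet` (letter
  `eSt`), `hOpp` (§8); **`epFamily_letters_of_epFunction_of_PS2`** — the same with `hOpp` discharged by §8 (one call at the junction, any place that has an EP function).
* §10 **`epFamily_letters_of_unramified`**, **`epFamily_letters_of_unramified_of_PS2`** — §9 at an UNRAMIFIED `v` (`hEP := exists_epFunction_G L v hns hunr νQv hcanQ`).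
* §11 **`epFamily_letters_of_tameRamified`**, **`epFamily_letters_of_tameRamified_of_PS2`** — §9 at a TAMELY RAMIFIED `v` (`hEP :=` ★ (G3)-RAM
  `EPGlueGRamified.exists_epFunction_G_of_ramified L v hns w he h2w νQv hcanQ`, binders `(w : PlacesOver L v) (he : v.asIdeal.ramificationIdx' w.1.asIdeal ≠ 1) (h2w : Valued.v (2 : w.1.adicCompletion L) = 1)`).

HONEST LABEL: count-neutral (helper; closes no node; RIDER 2a «EP-SPLIT» is priced by the LEAD); h413 OPEN; HC_CM is proved only modulo the 7 printed citations (2 remaining named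
inputs hLiu418 = stmt-HodgeConjecture-24832, h413 = stmt-HodgeConjecture-24833) until rung 0 closes.

## References
* [Rogawski1990] J. D. Rogawski, *Automorphic Representations of Unitary Groups in Three Variables*, Ann. of Math. Stud. 123 (1990): §12.6 p. 187, Prop. 12.6.1 (a)(c) p. 188,
  §12.7 pp. 192–195, §12.5 p. 184.
* [Kottwitz1988] R. E. Kottwitz, *Tamagawa numbers*, Ann. of Math. 127 (1988), §2 Theorem 2.
* [Tits1979] J. Tits, *Reductive groups over local fields*, PSPM 33.1 (1979), §2.4 (the ramified `²A₂` local data).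
-/

set_option autoImplicit false
-- the mandated namespace has the single-problem summit's repeated segment (`HodgeConjecture.HodgeConjecture`)
set_option linter.dupNamespace false

noncomputable section

open NumberField IsDedekindDomain MeasureTheory MeasureTheory.Measure Filter Topology Set
open scoped Matrix MatrixGroups ComplexConjugate
open Literature.NumberTheory.Rogawski1990 Literature.NumberTheory.Rogawski1990.Ch12Sec5
open Literature.NumberTheory.Automorphic Literature.NumberTheory.Automorphic.UnitaryGroup Literature.MeasureTheory.Group

namespace Summit.HodgeConjecture.HodgeConjecture.Cruxes.H413.F0P3cStCharTSEPPseudoCoeffStUnr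

open Summit.HodgeConjecture.HodgeConjecture.Cruxes.H413
open Summit.HodgeConjecture.HodgeConjecture.Cruxes.H413.F0P3cStCharTSEPPseudoCoeffSt
open Summit.HodgeConjecture.HodgeConjecture.Cruxes.H413.F0P3cStCharTSEPPseudoCoeffStLetters
open Summit.HodgeConjecture.HodgeConjecture.Cruxes.H413.F0P3cStCharTSTorusDefs

section Datum

variable (L : Type) [Field L] [NumberField L] [IsCMField L] (v : HeightOneSpectrum (𝓞 ↥(maximalRealSubfield L)))

/-! ## §8 The opposite-character relation for the kind-2 pair `{ψ∘det_G, St_G(ψ)}` (★ OPP-23 instantiated) -/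

/-- **`hOpp` FOR THE KIND-2 PAIR**: `χ_{St_G(ψ)} = −χ_{ψ∘det_G}` on `G^e`, i.e. ★ OPP-23 `F0P3cStCharTSOpp23.charOpposite_of_PS2` at `(π, σ) := (𝔇.detG ψ, 𝔇.stG ψ)` — binders: OPP-23's
own (COMPAT `hμG hreg`, `hEΩ`, ELL-OPEN `hopen`, (M1∀) `hM1`, the pair sockets (PS2) `hPS2` and (NONL2-PAR) `hNP` with the parameter map `par`) VERBATIM, then `hψ : Continuous ψ`,
`hDet : ¬ 𝔇.IsL2 (𝔇.detG ψ)`, `hSt : 𝔇.IsL2 (𝔇.stG ψ)`; the `IsEllipticPair` witness is the kind-2 disjunct.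
[cite: Rogawski1990, §12.6 Prop. 12.6.1 (c) p. 188; §12.7 L. 12.7.2 (proof) p. 192] -/
theorem charOpposite_stG_detG_of_PS2
    (hns : ∀ w : PlacesOver L v, IsCMField.complexConj L • w.1 = w.1)
    [MeasurableSpace (Gqs L v)] [BorelSpace (Gqs L v)]
    [∀ γ : Gqs L v, MeasurableSpace (Gqs L v ⧸ Subgroup.centralizer ({γ} : Set (Gqs L v)))]
    [∀ γ : Gqs L v, BorelSpace (Gqs L v ⧸ Subgroup.centralizer ({γ} : Set (Gqs L v)))]
    [MeasurableSpace (Gqs L v ⧸ Subgroup.center (Gqs L v))]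
    {H : Type} [Group H] [TopologicalSpace H] [IsTopologicalGroup H] [MeasurableSpace H]
    (νQv : Measure (Gqs L v)) [νQv.IsHaarMeasure] [νQv.IsMulRightInvariant]
    (mQv : OrbitalMeasureFamily (Gqs L v))
    (hcanQ : mQv.IsCanonical (fun γ => IsRegularElt (γ.val : GL (Fin 3) (UnitaryGroup.LocalRing L v))) νQv)
    (𝔇 : EllipticData (Gqs L v) H)
    (hμG : 𝔇.μG = νQv)
    (hreg : ∀ γ : Gqs L v, γ ∈ 𝔇.regG ↔ IsRegularElt (γ.val : GL (Fin 3) (UnitaryGroup.LocalRing L v)))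
    (hEΩ : ∀ γ ∈ 𝔇.ellG, IsRegularElt (γ.val : GL (Fin 3) (UnitaryGroup.LocalRing L v)) ∧ γ ∉ hyperbolicSet L v)
    (hopen : IsOpen {g : Gqs L v | IsRegularElt (g.val : GL (Fin 3) (UnitaryGroup.LocalRing L v)) ∧ g ∉ hyperbolicSet L v})
    (hM1 : ∀ π : IrrClass (Gqs L v), Measurable (𝔇.char π) ∧ LocallyIntegrable (𝔇.char π) 𝔇.μG ∧
      (∀ x ∈ 𝔇.regG, ∀ᶠ y in 𝓝 x, 𝔇.char π y = 𝔇.char π x) ∧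
      ∀ φ : Gqs L v → ℂ, IsLocSmooth φ → π.smoothTrace 𝔇.μG φ = ∫ x, φ x * 𝔇.char π x ∂𝔇.μG)
    (par : IrrClass (Gqs L v) → (((UnitaryGroup.LocalRing L v)ˣ →* ℂˣ) × (↥(normOneUnits (conjLocal L (IsCMField.complexConj L) v)) →* ℂˣ)))
    (hPS2 : ∀ π σ : IrrClass (Gqs L v), ¬ 𝔇.IsL2 π → 𝔇.IsL2 σ → 𝔇.IsEllipticPair π σ → ∀ f : Gqs L v → ℂ, IsLocSmooth f →
        π.smoothTrace νQv f + σ.smoothTrace νQv f = Representation.smoothTrace (G := Gqs L v) (UnitaryGroup.cmPrincipalSeries L 3 v (UnitaryGroup.cmTorusCharPair L v (par π).1 (par π).2)) νQv f)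
    (hNP : ∀ π : IrrClass (Gqs L v), ¬ 𝔇.IsL2 π →
        π.IsConstituentOf (UnitaryGroup.cmPrincipalSeries L 3 v (UnitaryGroup.cmTorusCharPair L v (par π).1 (par π).2)) ∧
          Continuous (par π).1 ∧ Continuous (par π).2)
    {ψ : ↥(Subgroup.center (Gqs L v)) →* ℂˣ} (hψ : Continuous ψ)
    (hDet : ¬ 𝔇.IsL2 (𝔇.detG ψ)) (hSt : 𝔇.IsL2 (𝔇.stG ψ)) :
    ∀ γ ∈ 𝔇.ellG, 𝔇.char (𝔇.stG ψ) γ = -𝔇.char (𝔇.detG ψ) γ :=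
  F0P3cStCharTSOpp23.charOpposite_of_PS2 L v hns νQv mQv hcanQ 𝔇 hμG hreg hEΩ hopen hM1 par hPS2 hNP (𝔇.detG ψ) (𝔇.stG ψ) hDet hSt
    (Or.inr (Or.inl ⟨ψ, hψ, Or.inr ⟨rfl, rfl⟩⟩))

/-! ## §9 The three EP-family letters from an Euler–Poincaré function BY SHAPE (place-agnostic), composed by name -/

/-- **THE EP-FAMILY LETTERS FROM AN EULER–POINCARÉ FUNCTION, BY SHAPE** (K1 at `ψ∘det_G`; K1 ∧ POS-ONE at `St_G(ψ)`; K2′ at `St_G(ψ)`), on `U(Φ₃)(L⁺_v)` at ANY non-split `v` carrying an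
Euler–Poincaré function: `hEP` = the common conclusion of ★ (G3) `F0P3cStCharTSEPGlueG.exists_epFunction_G` (unramified `v`) and of (G3)-RAM `exists_epFunction_G_of_ramified` (tame
ramified `v`), VERBATIM, is fed token for token to FILE B §6 (`exists_isPseudoCoeff_detG_of_epFunction`, `exists_isPseudoCoeff_stG_of_epFunction`) and, clause by clause, to ★ (G4)
`F0P3cStCharTSEllMassG.ellipticWeylMass_G_eq_one_of_epFunction_of_l2CharOnTorusAll`, whose conclusion is FILE B §7's `hMass` (`innerG_char_stG_self_eq_one_of_mass`).  Binders: COMPAT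
`hμG horb hreg`; the pin `hE`; (M1∀) `hM1`; the carpet relations `hWIF hC1 hC2 hC3 hL2` (★ (G4)'s own); `hEP`; `hψ`; the DET pin `detZ hopen hdet` (rung-0 letter `eSt`); `hOpp` (§8).
[cite: Rogawski1990, §12.6 p. 187; Prop. 12.6.1 (a)(c) p. 188; §12.5 p. 184] [cite: Kottwitz1988, §2 Theorem 2] -/
theorem epFamily_letters_of_epFunction
    (hns : ∀ w : PlacesOver L v, IsCMField.complexConj L • w.1 = w.1)
    [MeasurableSpace (Gqs L v)] [BorelSpace (Gqs L v)]
    [∀ γ : Gqs L v, MeasurableSpace (Gqs L v ⧸ Subgroup.centralizer ({γ} : Set (Gqs L v)))]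
    [∀ γ : Gqs L v, BorelSpace (Gqs L v ⧸ Subgroup.centralizer ({γ} : Set (Gqs L v)))]
    [MeasurableSpace (Gqs L v ⧸ Subgroup.center (Gqs L v))]
    {H : Type} [Group H] [TopologicalSpace H] [IsTopologicalGroup H] [MeasurableSpace H]
    (νQv : Measure (Gqs L v)) [νQv.IsHaarMeasure] [νQv.IsMulRightInvariant]
    {mQv : OrbitalMeasureFamily (Gqs L v)}
    (hcanQ : mQv.IsCanonical (fun γ => IsRegularElt (γ.val : GL (Fin 3) (UnitaryGroup.LocalRing L v))) νQv)
    (𝔇 : EllipticData (Gqs L v) H)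
    -- ══ COMPAT (hC01, hC04, hC05) ══
    (hμG : 𝔇.μG = νQv) (horb : 𝔇.orb = mQv)
    (hreg : ∀ γ : Gqs L v, γ ∈ 𝔇.regG ↔ IsRegularElt (γ.val : GL (Fin 3) (UnitaryGroup.LocalRing L v)))
    -- ══ the elliptic set (pin `hE`) and (M1∀) ══
    (hE : ∀ γ : Gqs L v, γ ∈ 𝔇.ellG ↔ IsRegularElt (γ.val : GL (Fin 3) (UnitaryGroup.LocalRing L v)) ∧ γ ∉ hyperbolicSet L v)
    (hM1 : ∀ π : IrrClass (Gqs L v), Measurable (𝔇.char π) ∧ LocallyIntegrable (𝔇.char π) 𝔇.μG ∧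
      (∀ x ∈ 𝔇.regG, ∀ᶠ y in 𝓝 x, 𝔇.char π y = 𝔇.char π x) ∧
      ∀ φ : Gqs L v → ℂ, IsLocSmooth φ → π.smoothTrace 𝔇.μG φ = ∫ x, φ x * 𝔇.char π x ∂𝔇.μG)
    -- ══ carpet relations (★ (G4)'s binders, token for token) ══
    (hWIF : 𝔇.WeylIntegrationFormula) (hC1 : 𝔇.EllCartanSubset) (hC2 : 𝔇.EllCartanAE) (hC3 : 𝔇.NonEllCartanAE) (hL2 : 𝔇.L2CharOnTorusAll)
    -- ══ the Euler–Poincaré function BY SHAPE (the eight clauses of (G3) ∕ (G3)-RAM) ══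
    (hEP : ∃ fG : Gqs L v → ℂ, IsLocSmooth fG ∧ Measurable fG ∧ Integrable fG νQv ∧ ∫ g, fG g ∂νQv = 1 ∧
      (fG 1).im = 0 ∧ (fG 1).re < 0 ∧
      (∀ γ : Gqs L v, IsRegularElt (γ.val : GL (Fin 3) (UnitaryGroup.LocalRing L v)) →
        IsCompact ((Subgroup.centralizer ({γ} : Set (Gqs L v))) : Set (Gqs L v)) → classOrbitalIntegral mQv fG (ConjClasses.mk γ) = 1) ∧
      (∀ γ : Gqs L v, IsRegularElt (γ.val : GL (Fin 3) (UnitaryGroup.LocalRing L v)) →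
        ¬ IsCompact ((Subgroup.centralizer ({γ} : Set (Gqs L v))) : Set (Gqs L v)) → classOrbitalIntegral mQv fG (ConjClasses.mk γ) = 0))
    -- ══ the character `ψ` of the centre and the DET pin (letter `eSt`) ══
    {ψ : ↥(Subgroup.center (Gqs L v)) →* ℂˣ} (hψ : Continuous ψ) (detZ : Gqs L v →* ↥(Subgroup.center (Gqs L v)))
    (hopen : IsOpen (((ψ.comp detZ).ker : Subgroup (Gqs L v)) : Set (Gqs L v)))
    (hdet : 𝔇.detG ψ = IrrClass.mk (SmoothIrrep.ofChar (ψ.comp detZ) hopen))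
    -- ══ the opposite-character relation (§8) ══
    (hOpp : ∀ γ ∈ 𝔇.ellG, 𝔇.char (𝔇.stG ψ) γ = -𝔇.char (𝔇.detG ψ) γ) :
    (∃ f : Gqs L v → ℂ, 𝔇.IsPseudoCoeff (𝔇.detG ψ) f) ∧
      (∃ f : Gqs L v → ℂ, 𝔇.IsPseudoCoeff (𝔇.stG ψ) f ∧ 0 < (f 1).re ∧ (f 1).im = 0) ∧
      𝔇.innerG (𝔇.char (𝔇.stG ψ)) (𝔇.char (𝔇.stG ψ)) = 1 := by
  refine ⟨exists_isPseudoCoeff_detG_of_epFunction L v hns νQv mQv 𝔇 hμG horb hreg hE hM1 hEP ψ detZ hopen hdet,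
    exists_isPseudoCoeff_stG_of_epFunction L v hns νQv mQv 𝔇 hμG horb hreg hE hM1 hEP ψ detZ hopen hdet hOpp, ?_⟩
  -- (G4): the elliptic Weyl mass is one, from the eight EP clauses
  obtain ⟨fG, hfs, hfm, hfi, hf1, hfim, hfre, hfE, hfN⟩ := hEP
  exact innerG_char_stG_self_eq_one_of_mass L v hns νQv 𝔇 hμG hreg hE hM1 hC2
    (F0P3cStCharTSEllMassG.ellipticWeylMass_G_eq_one_of_epFunction_of_l2CharOnTorusAll L v hns νQv hcanQ 𝔇 hμG horb hreg hE hM1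
      hWIF hC1 hC2 hC3 hL2 fG hfs hfm hfi hf1 hfim hfre hfE hfN)
    hψ detZ hopen hdet hOpp

/-- **THE EP-FAMILY LETTERS FROM AN EULER–POINCARÉ FUNCTION BY SHAPE, ONE CALL**: `epFamily_letters_of_epFunction` with `hOpp` supplied by §8 — binders: COMPAT `hμG horb hreg`; the pin `hE`; ELL-OPEN `hopen'`;
(M1∀) `hM1`; the carpet relations `hWIF hC1 hC2 hC3 hL2`; `hEP` (the eight EP clauses); the pair sockets `par hPS2 hNP` (OPP-23's, VERBATIM); `hψ`; the DET pin `detZ hopen hdet`; `hDet : ¬ 𝔇.IsL2 (𝔇.detG ψ)`,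
`hSt : 𝔇.IsL2 (𝔇.stG ψ)`.  Conclusion: K1 at `ψ∘det_G` ∧ (K1 ∧ POS-ONE) at `St_G(ψ)` ∧ K2′ at `St_G(ψ)`.
[cite: Rogawski1990, §12.6 p. 187; Prop. 12.6.1 (a)(c) p. 188; §12.7 L. 12.7.2 (proof) p. 192] [cite: Kottwitz1988, §2 Theorem 2] -/
theorem epFamily_letters_of_epFunction_of_PS2
    (hns : ∀ w : PlacesOver L v, IsCMField.complexConj L • w.1 = w.1)
    [MeasurableSpace (Gqs L v)] [BorelSpace (Gqs L v)]
    [∀ γ : Gqs L v, MeasurableSpace (Gqs L v ⧸ Subgroup.centralizer ({γ} : Set (Gqs L v)))]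
    [∀ γ : Gqs L v, BorelSpace (Gqs L v ⧸ Subgroup.centralizer ({γ} : Set (Gqs L v)))]
    [MeasurableSpace (Gqs L v ⧸ Subgroup.center (Gqs L v))]
    {H : Type} [Group H] [TopologicalSpace H] [IsTopologicalGroup H] [MeasurableSpace H]
    (νQv : Measure (Gqs L v)) [νQv.IsHaarMeasure] [νQv.IsMulRightInvariant]
    {mQv : OrbitalMeasureFamily (Gqs L v)}
    (hcanQ : mQv.IsCanonical (fun γ => IsRegularElt (γ.val : GL (Fin 3) (UnitaryGroup.LocalRing L v))) νQv)
    (𝔇 : EllipticData (Gqs L v) H)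
    (hμG : 𝔇.μG = νQv) (horb : 𝔇.orb = mQv)
    (hreg : ∀ γ : Gqs L v, γ ∈ 𝔇.regG ↔ IsRegularElt (γ.val : GL (Fin 3) (UnitaryGroup.LocalRing L v)))
    (hE : ∀ γ : Gqs L v, γ ∈ 𝔇.ellG ↔ IsRegularElt (γ.val : GL (Fin 3) (UnitaryGroup.LocalRing L v)) ∧ γ ∉ hyperbolicSet L v)
    (hopen' : IsOpen {g : Gqs L v | IsRegularElt (g.val : GL (Fin 3) (UnitaryGroup.LocalRing L v)) ∧ g ∉ hyperbolicSet L v})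
    (hM1 : ∀ π : IrrClass (Gqs L v), Measurable (𝔇.char π) ∧ LocallyIntegrable (𝔇.char π) 𝔇.μG ∧
      (∀ x ∈ 𝔇.regG, ∀ᶠ y in 𝓝 x, 𝔇.char π y = 𝔇.char π x) ∧
      ∀ φ : Gqs L v → ℂ, IsLocSmooth φ → π.smoothTrace 𝔇.μG φ = ∫ x, φ x * 𝔇.char π x ∂𝔇.μG)
    (hWIF : 𝔇.WeylIntegrationFormula) (hC1 : 𝔇.EllCartanSubset) (hC2 : 𝔇.EllCartanAE) (hC3 : 𝔇.NonEllCartanAE) (hL2 : 𝔇.L2CharOnTorusAll)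
    (hEP : ∃ fG : Gqs L v → ℂ, IsLocSmooth fG ∧ Measurable fG ∧ Integrable fG νQv ∧ ∫ g, fG g ∂νQv = 1 ∧
      (fG 1).im = 0 ∧ (fG 1).re < 0 ∧
      (∀ γ : Gqs L v, IsRegularElt (γ.val : GL (Fin 3) (UnitaryGroup.LocalRing L v)) →
        IsCompact ((Subgroup.centralizer ({γ} : Set (Gqs L v))) : Set (Gqs L v)) → classOrbitalIntegral mQv fG (ConjClasses.mk γ) = 1) ∧
      (∀ γ : Gqs L v, IsRegularElt (γ.val : GL (Fin 3) (UnitaryGroup.LocalRing L v)) →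
        ¬ IsCompact ((Subgroup.centralizer ({γ} : Set (Gqs L v))) : Set (Gqs L v)) → classOrbitalIntegral mQv fG (ConjClasses.mk γ) = 0))
    (par : IrrClass (Gqs L v) → (((UnitaryGroup.LocalRing L v)ˣ →* ℂˣ) × (↥(normOneUnits (conjLocal L (IsCMField.complexConj L) v)) →* ℂˣ)))
    (hPS2 : ∀ π σ : IrrClass (Gqs L v), ¬ 𝔇.IsL2 π → 𝔇.IsL2 σ → 𝔇.IsEllipticPair π σ → ∀ f : Gqs L v → ℂ, IsLocSmooth f →
        π.smoothTrace νQv f + σ.smoothTrace νQv f = Representation.smoothTrace (G := Gqs L v) (UnitaryGroup.cmPrincipalSeries L 3 v (UnitaryGroup.cmTorusCharPair L v (par π).1 (par π).2)) νQv f)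
    (hNP : ∀ π : IrrClass (Gqs L v), ¬ 𝔇.IsL2 π →
        π.IsConstituentOf (UnitaryGroup.cmPrincipalSeries L 3 v (UnitaryGroup.cmTorusCharPair L v (par π).1 (par π).2)) ∧
          Continuous (par π).1 ∧ Continuous (par π).2)
    {ψ : ↥(Subgroup.center (Gqs L v)) →* ℂˣ} (hψ : Continuous ψ) (detZ : Gqs L v →* ↥(Subgroup.center (Gqs L v)))
    (hopen : IsOpen (((ψ.comp detZ).ker : Subgroup (Gqs L v)) : Set (Gqs L v)))
    (hdet : 𝔇.detG ψ = IrrClass.mk (SmoothIrrep.ofChar (ψ.comp detZ) hopen))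
    (hDet : ¬ 𝔇.IsL2 (𝔇.detG ψ)) (hSt : 𝔇.IsL2 (𝔇.stG ψ)) :
    (∃ f : Gqs L v → ℂ, 𝔇.IsPseudoCoeff (𝔇.detG ψ) f) ∧
      (∃ f : Gqs L v → ℂ, 𝔇.IsPseudoCoeff (𝔇.stG ψ) f ∧ 0 < (f 1).re ∧ (f 1).im = 0) ∧
      𝔇.innerG (𝔇.char (𝔇.stG ψ)) (𝔇.char (𝔇.stG ψ)) = 1 :=
  epFamily_letters_of_epFunction L v hns νQv hcanQ 𝔇 hμG horb hreg hE hM1 hWIF hC1 hC2 hC3 hL2 hEP hψ detZ hopen hdet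
    (charOpposite_stG_detG_of_PS2 L v hns νQv mQv hcanQ 𝔇 hμG hreg (fun γ hγ => (hE γ).1 hγ) hopen' hM1 par hPS2 hNP hψ hDet hSt)

/-! ## §10 At an UNRAMIFIED non-split place: `hEP :=` ★ (G3) `exists_epFunction_G` -/

/-- **THE EP-FAMILY LETTERS AT AN UNRAMIFIED NON-SPLIT PLACE** (K1 at `ψ∘det_G`; K1 ∧ POS-ONE at `St_G(ψ)`; K2′ at `St_G(ψ)`): §9 `epFamily_letters_of_epFunction` with `hEP :=` ★ (G3)
`F0P3cStCharTSEPGlueG.exists_epFunction_G L v hns hunr νQv hcanQ` (Kottwitz's Euler–Poincaré function on `U(Φ₃)(L⁺_v)`, `v` UNRAMIFIED).  Binders: COMPAT `hμG horb hreg`; the pin `hE`; (M1∀) `hM1`; the carpet relations `hWIF hC1 hC2 hC3 hL2` (★ (G4)'s own); `hψ`; the DET pin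
`detZ hopen hdet` (rung-0 letter `eSt`); `hOpp` (§8). [cite: Rogawski1990, §12.6 p. 187; Prop. 12.6.1 (a)(c) p. 188; §12.5 p. 184] [cite: Kottwitz1988, §2 Theorem 2] -/
theorem epFamily_letters_of_unramified
    (hns : ∀ w : PlacesOver L v, IsCMField.complexConj L • w.1 = w.1)
    (hunr : Algebra.IsUnramifiedIn (𝓞 L) v.asIdeal)
    [MeasurableSpace (Gqs L v)] [BorelSpace (Gqs L v)]
    [∀ γ : Gqs L v, MeasurableSpace (Gqs L v ⧸ Subgroup.centralizer ({γ} : Set (Gqs L v)))]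
    [∀ γ : Gqs L v, BorelSpace (Gqs L v ⧸ Subgroup.centralizer ({γ} : Set (Gqs L v)))]
    [MeasurableSpace (Gqs L v ⧸ Subgroup.center (Gqs L v))]
    {H : Type} [Group H] [TopologicalSpace H] [IsTopologicalGroup H] [MeasurableSpace H]
    (νQv : Measure (Gqs L v)) [νQv.IsHaarMeasure] [νQv.IsMulRightInvariant]
    {mQv : OrbitalMeasureFamily (Gqs L v)}
    (hcanQ : mQv.IsCanonical (fun γ => IsRegularElt (γ.val : GL (Fin 3) (UnitaryGroup.LocalRing L v))) νQv)
    (𝔇 : EllipticData (Gqs L v) H)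
    -- ══ COMPAT (hC01, hC04, hC05) ══
    (hμG : 𝔇.μG = νQv) (horb : 𝔇.orb = mQv)
    (hreg : ∀ γ : Gqs L v, γ ∈ 𝔇.regG ↔ IsRegularElt (γ.val : GL (Fin 3) (UnitaryGroup.LocalRing L v)))
    -- ══ the elliptic set (pin `hE`) and (M1∀) ══
    (hE : ∀ γ : Gqs L v, γ ∈ 𝔇.ellG ↔ IsRegularElt (γ.val : GL (Fin 3) (UnitaryGroup.LocalRing L v)) ∧ γ ∉ hyperbolicSet L v)
    (hM1 : ∀ π : IrrClass (Gqs L v), Measurable (𝔇.char π) ∧ LocallyIntegrable (𝔇.char π) 𝔇.μG ∧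
      (∀ x ∈ 𝔇.regG, ∀ᶠ y in 𝓝 x, 𝔇.char π y = 𝔇.char π x) ∧
      ∀ φ : Gqs L v → ℂ, IsLocSmooth φ → π.smoothTrace 𝔇.μG φ = ∫ x, φ x * 𝔇.char π x ∂𝔇.μG)
    -- ══ carpet relations (★ (G4)'s binders, token for token) ══
    (hWIF : 𝔇.WeylIntegrationFormula) (hC1 : 𝔇.EllCartanSubset) (hC2 : 𝔇.EllCartanAE) (hC3 : 𝔇.NonEllCartanAE) (hL2 : 𝔇.L2CharOnTorusAll)
    -- ══ the character `ψ` of the centre and the DET pin (letter `eSt`) ══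
    {ψ : ↥(Subgroup.center (Gqs L v)) →* ℂˣ} (hψ : Continuous ψ) (detZ : Gqs L v →* ↥(Subgroup.center (Gqs L v)))
    (hopen : IsOpen (((ψ.comp detZ).ker : Subgroup (Gqs L v)) : Set (Gqs L v)))
    (hdet : 𝔇.detG ψ = IrrClass.mk (SmoothIrrep.ofChar (ψ.comp detZ) hopen))
    -- ══ the opposite-character relation (§8) ══
    (hOpp : ∀ γ ∈ 𝔇.ellG, 𝔇.char (𝔇.stG ψ) γ = -𝔇.char (𝔇.detG ψ) γ) :
    (∃ f : Gqs L v → ℂ, 𝔇.IsPseudoCoeff (𝔇.detG ψ) f) ∧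
      (∃ f : Gqs L v → ℂ, 𝔇.IsPseudoCoeff (𝔇.stG ψ) f ∧ 0 < (f 1).re ∧ (f 1).im = 0) ∧
      𝔇.innerG (𝔇.char (𝔇.stG ψ)) (𝔇.char (𝔇.stG ψ)) = 1 :=
  epFamily_letters_of_epFunction L v hns νQv hcanQ 𝔇 hμG horb hreg hE hM1 hWIF hC1 hC2 hC3 hL2
    (F0P3cStCharTSEPGlueG.exists_epFunction_G L v hns hunr νQv hcanQ) hψ detZ hopen hdet hOpp

/-- **THE EP-FAMILY LETTERS AT AN UNRAMIFIED NON-SPLIT PLACE, ONE CALL**: §9's one-call form at `hEP :=` ★ (G3) `exists_epFunction_G` — binders: `hunr`; COMPAT `hμG horb hreg`; the pin `hE`; ELL-OPEN `hopen'`;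
(M1∀) `hM1`; the carpet relations `hWIF hC1 hC2 hC3 hL2`; the pair sockets `par hPS2 hNP` (OPP-23's, VERBATIM); `hψ`; the DET pin `detZ hopen hdet`; `hDet : ¬ 𝔇.IsL2 (𝔇.detG ψ)`,
`hSt : 𝔇.IsL2 (𝔇.stG ψ)`.  Conclusion: K1 at `ψ∘det_G` ∧ (K1 ∧ POS-ONE) at `St_G(ψ)` ∧ K2′ at `St_G(ψ)`.
[cite: Rogawski1990, §12.6 p. 187; Prop. 12.6.1 (a)(c) p. 188; §12.7 L. 12.7.2 (proof) p. 192] [cite: Kottwitz1988, §2 Theorem 2] -/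
theorem epFamily_letters_of_unramified_of_PS2
    (hns : ∀ w : PlacesOver L v, IsCMField.complexConj L • w.1 = w.1)
    (hunr : Algebra.IsUnramifiedIn (𝓞 L) v.asIdeal)
    [MeasurableSpace (Gqs L v)] [BorelSpace (Gqs L v)]
    [∀ γ : Gqs L v, MeasurableSpace (Gqs L v ⧸ Subgroup.centralizer ({γ} : Set (Gqs L v)))]
    [∀ γ : Gqs L v, BorelSpace (Gqs L v ⧸ Subgroup.centralizer ({γ} : Set (Gqs L v)))]
    [MeasurableSpace (Gqs L v ⧸ Subgroup.center (Gqs L v))]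
    {H : Type} [Group H] [TopologicalSpace H] [IsTopologicalGroup H] [MeasurableSpace H]
    (νQv : Measure (Gqs L v)) [νQv.IsHaarMeasure] [νQv.IsMulRightInvariant]
    {mQv : OrbitalMeasureFamily (Gqs L v)}
    (hcanQ : mQv.IsCanonical (fun γ => IsRegularElt (γ.val : GL (Fin 3) (UnitaryGroup.LocalRing L v))) νQv)
    (𝔇 : EllipticData (Gqs L v) H)
    (hμG : 𝔇.μG = νQv) (horb : 𝔇.orb = mQv)
    (hreg : ∀ γ : Gqs L v, γ ∈ 𝔇.regG ↔ IsRegularElt (γ.val : GL (Fin 3) (UnitaryGroup.LocalRing L v)))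
    (hE : ∀ γ : Gqs L v, γ ∈ 𝔇.ellG ↔ IsRegularElt (γ.val : GL (Fin 3) (UnitaryGroup.LocalRing L v)) ∧ γ ∉ hyperbolicSet L v)
    (hopen' : IsOpen {g : Gqs L v | IsRegularElt (g.val : GL (Fin 3) (UnitaryGroup.LocalRing L v)) ∧ g ∉ hyperbolicSet L v})
    (hM1 : ∀ π : IrrClass (Gqs L v), Measurable (𝔇.char π) ∧ LocallyIntegrable (𝔇.char π) 𝔇.μG ∧
      (∀ x ∈ 𝔇.regG, ∀ᶠ y in 𝓝 x, 𝔇.char π y = 𝔇.char π x) ∧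
      ∀ φ : Gqs L v → ℂ, IsLocSmooth φ → π.smoothTrace 𝔇.μG φ = ∫ x, φ x * 𝔇.char π x ∂𝔇.μG)
    (hWIF : 𝔇.WeylIntegrationFormula) (hC1 : 𝔇.EllCartanSubset) (hC2 : 𝔇.EllCartanAE) (hC3 : 𝔇.NonEllCartanAE) (hL2 : 𝔇.L2CharOnTorusAll)
    (par : IrrClass (Gqs L v) → (((UnitaryGroup.LocalRing L v)ˣ →* ℂˣ) × (↥(normOneUnits (conjLocal L (IsCMField.complexConj L) v)) →* ℂˣ)))
    (hPS2 : ∀ π σ : IrrClass (Gqs L v), ¬ 𝔇.IsL2 π → 𝔇.IsL2 σ → 𝔇.IsEllipticPair π σ → ∀ f : Gqs L v → ℂ, IsLocSmooth f →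
        π.smoothTrace νQv f + σ.smoothTrace νQv f = Representation.smoothTrace (G := Gqs L v) (UnitaryGroup.cmPrincipalSeries L 3 v (UnitaryGroup.cmTorusCharPair L v (par π).1 (par π).2)) νQv f)
    (hNP : ∀ π : IrrClass (Gqs L v), ¬ 𝔇.IsL2 π →
        π.IsConstituentOf (UnitaryGroup.cmPrincipalSeries L 3 v (UnitaryGroup.cmTorusCharPair L v (par π).1 (par π).2)) ∧
          Continuous (par π).1 ∧ Continuous (par π).2)
    {ψ : ↥(Subgroup.center (Gqs L v)) →* ℂˣ} (hψ : Continuous ψ) (detZ : Gqs L v →* ↥(Subgroup.center (Gqs L v)))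
    (hopen : IsOpen (((ψ.comp detZ).ker : Subgroup (Gqs L v)) : Set (Gqs L v)))
    (hdet : 𝔇.detG ψ = IrrClass.mk (SmoothIrrep.ofChar (ψ.comp detZ) hopen))
    (hDet : ¬ 𝔇.IsL2 (𝔇.detG ψ)) (hSt : 𝔇.IsL2 (𝔇.stG ψ)) :
    (∃ f : Gqs L v → ℂ, 𝔇.IsPseudoCoeff (𝔇.detG ψ) f) ∧
      (∃ f : Gqs L v → ℂ, 𝔇.IsPseudoCoeff (𝔇.stG ψ) f ∧ 0 < (f 1).re ∧ (f 1).im = 0) ∧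
      𝔇.innerG (𝔇.char (𝔇.stG ψ)) (𝔇.char (𝔇.stG ψ)) = 1 :=
  epFamily_letters_of_epFunction_of_PS2 L v hns νQv hcanQ 𝔇 hμG horb hreg hE hopen' hM1 hWIF hC1 hC2 hC3 hL2
    (F0P3cStCharTSEPGlueG.exists_epFunction_G L v hns hunr νQv hcanQ) par hPS2 hNP hψ detZ hopen hdet hDet hSt

/-! ## §11 At a TAMELY RAMIFIED non-split place: `hEP :=` ★ (G3)-RAM `exists_epFunction_G_of_ramified` -/

/-- **THE EP-FAMILY LETTERS AT A TAMELY RAMIFIED NON-SPLIT PLACE** (K1 at `ψ∘det_G`; K1 ∧ POS-ONE at `St_G(ψ)`; K2′ at `St_G(ψ)`): §9 `epFamily_letters_of_epFunction` with `hEP :=` ★ (G3)-RAM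
`F0P3cStCharTSEPGlueGRamified.exists_epFunction_G_of_ramified L v hns w he h2w νQv hcanQ` (Kottwitz's Euler–Poincaré function on `U(Φ₃)(L⁺_v)`, `v` TAMELY RAMIFIED: `e(w|v) ≠ 1`, `|2|_w = 1`).  Binders: COMPAT `hμG horb hreg`; the pin `hE`; (M1∀) `hM1`; the carpet relations `hWIF hC1 hC2 hC3 hL2` (★ (G4)'s own); `hψ`; the DET pin
`detZ hopen hdet` (rung-0 letter `eSt`); `hOpp` (§8). [cite: Rogawski1990, §12.6 p. 187; Prop. 12.6.1 (a)(c) p. 188; §12.5 p. 184] [cite: Kottwitz1988, §2 Theorem 2] [cite: Tits1979, §2.4] -/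
theorem epFamily_letters_of_tameRamified
    (hns : ∀ w : PlacesOver L v, IsCMField.complexConj L • w.1 = w.1)
    (w : PlacesOver L v) (he : v.asIdeal.ramificationIdx' w.1.asIdeal ≠ 1) (h2w : Valued.v (2 : w.1.adicCompletion L) = 1)
    [MeasurableSpace (Gqs L v)] [BorelSpace (Gqs L v)]
    [∀ γ : Gqs L v, MeasurableSpace (Gqs L v ⧸ Subgroup.centralizer ({γ} : Set (Gqs L v)))]
    [∀ γ : Gqs L v, BorelSpace (Gqs L v ⧸ Subgroup.centralizer ({γ} : Set (Gqs L v)))]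
    [MeasurableSpace (Gqs L v ⧸ Subgroup.center (Gqs L v))]
    {H : Type} [Group H] [TopologicalSpace H] [IsTopologicalGroup H] [MeasurableSpace H]
    (νQv : Measure (Gqs L v)) [νQv.IsHaarMeasure] [νQv.IsMulRightInvariant]
    {mQv : OrbitalMeasureFamily (Gqs L v)}
    (hcanQ : mQv.IsCanonical (fun γ => IsRegularElt (γ.val : GL (Fin 3) (UnitaryGroup.LocalRing L v))) νQv)
    (𝔇 : EllipticData (Gqs L v) H)
    -- ══ COMPAT (hC01, hC04, hC05) ══
    (hμG : 𝔇.μG = νQv) (horb : 𝔇.orb = mQv)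
    (hreg : ∀ γ : Gqs L v, γ ∈ 𝔇.regG ↔ IsRegularElt (γ.val : GL (Fin 3) (UnitaryGroup.LocalRing L v)))
    -- ══ the elliptic set (pin `hE`) and (M1∀) ══
    (hE : ∀ γ : Gqs L v, γ ∈ 𝔇.ellG ↔ IsRegularElt (γ.val : GL (Fin 3) (UnitaryGroup.LocalRing L v)) ∧ γ ∉ hyperbolicSet L v)
    (hM1 : ∀ π : IrrClass (Gqs L v), Measurable (𝔇.char π) ∧ LocallyIntegrable (𝔇.char π) 𝔇.μG ∧
      (∀ x ∈ 𝔇.regG, ∀ᶠ y in 𝓝 x, 𝔇.char π y = 𝔇.char π x) ∧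
      ∀ φ : Gqs L v → ℂ, IsLocSmooth φ → π.smoothTrace 𝔇.μG φ = ∫ x, φ x * 𝔇.char π x ∂𝔇.μG)
    -- ══ carpet relations (★ (G4)'s binders, token for token) ══
    (hWIF : 𝔇.WeylIntegrationFormula) (hC1 : 𝔇.EllCartanSubset) (hC2 : 𝔇.EllCartanAE) (hC3 : 𝔇.NonEllCartanAE) (hL2 : 𝔇.L2CharOnTorusAll)
    -- ══ the character `ψ` of the centre and the DET pin (letter `eSt`) ══
    {ψ : ↥(Subgroup.center (Gqs L v)) →* ℂˣ} (hψ : Continuous ψ) (detZ : Gqs L v →* ↥(Subgroup.center (Gqs L v)))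
    (hopen : IsOpen (((ψ.comp detZ).ker : Subgroup (Gqs L v)) : Set (Gqs L v)))
    (hdet : 𝔇.detG ψ = IrrClass.mk (SmoothIrrep.ofChar (ψ.comp detZ) hopen))
    -- ══ the opposite-character relation (§8) ══
    (hOpp : ∀ γ ∈ 𝔇.ellG, 𝔇.char (𝔇.stG ψ) γ = -𝔇.char (𝔇.detG ψ) γ) :
    (∃ f : Gqs L v → ℂ, 𝔇.IsPseudoCoeff (𝔇.detG ψ) f) ∧
      (∃ f : Gqs L v → ℂ, 𝔇.IsPseudoCoeff (𝔇.stG ψ) f ∧ 0 < (f 1).re ∧ (f 1).im = 0) ∧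
      𝔇.innerG (𝔇.char (𝔇.stG ψ)) (𝔇.char (𝔇.stG ψ)) = 1 :=
  epFamily_letters_of_epFunction L v hns νQv hcanQ 𝔇 hμG horb hreg hE hM1 hWIF hC1 hC2 hC3 hL2
    (F0P3cStCharTSEPGlueGRamified.exists_epFunction_G_of_ramified L v hns w he h2w νQv hcanQ) hψ detZ hopen hdet hOpp

/-- **THE EP-FAMILY LETTERS AT A TAMELY RAMIFIED NON-SPLIT PLACE, ONE CALL**: §9's one-call form at `hEP :=` ★ (G3)-RAM `exists_epFunction_G_of_ramified` — binders: `w he h2w`; COMPAT `hμG horb hreg`; the pin `hE`; ELL-OPEN `hopen'`;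
(M1∀) `hM1`; the carpet relations `hWIF hC1 hC2 hC3 hL2`; the pair sockets `par hPS2 hNP` (OPP-23's, VERBATIM); `hψ`; the DET pin `detZ hopen hdet`; `hDet : ¬ 𝔇.IsL2 (𝔇.detG ψ)`,
`hSt : 𝔇.IsL2 (𝔇.stG ψ)`.  Conclusion: K1 at `ψ∘det_G` ∧ (K1 ∧ POS-ONE) at `St_G(ψ)` ∧ K2′ at `St_G(ψ)`.
[cite: Rogawski1990, §12.6 p. 187; Prop. 12.6.1 (a)(c) p. 188; §12.7 L. 12.7.2 (proof) p. 192] [cite: Kottwitz1988, §2 Theorem 2] -/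
theorem epFamily_letters_of_tameRamified_of_PS2
    (hns : ∀ w : PlacesOver L v, IsCMField.complexConj L • w.1 = w.1)
    (w : PlacesOver L v) (he : v.asIdeal.ramificationIdx' w.1.asIdeal ≠ 1) (h2w : Valued.v (2 : w.1.adicCompletion L) = 1)
    [MeasurableSpace (Gqs L v)] [BorelSpace (Gqs L v)]
    [∀ γ : Gqs L v, MeasurableSpace (Gqs L v ⧸ Subgroup.centralizer ({γ} : Set (Gqs L v)))]
    [∀ γ : Gqs L v, BorelSpace (Gqs L v ⧸ Subgroup.centralizer ({γ} : Set (Gqs L v)))]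
    [MeasurableSpace (Gqs L v ⧸ Subgroup.center (Gqs L v))]
    {H : Type} [Group H] [TopologicalSpace H] [IsTopologicalGroup H] [MeasurableSpace H]
    (νQv : Measure (Gqs L v)) [νQv.IsHaarMeasure] [νQv.IsMulRightInvariant]
    {mQv : OrbitalMeasureFamily (Gqs L v)}
    (hcanQ : mQv.IsCanonical (fun γ => IsRegularElt (γ.val : GL (Fin 3) (UnitaryGroup.LocalRing L v))) νQv)
    (𝔇 : EllipticData (Gqs L v) H)
    (hμG : 𝔇.μG = νQv) (horb : 𝔇.orb = mQv)
    (hreg : ∀ γ : Gqs L v, γ ∈ 𝔇.regG ↔ IsRegularElt (γ.val : GL (Fin 3) (UnitaryGroup.LocalRing L v)))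
    (hE : ∀ γ : Gqs L v, γ ∈ 𝔇.ellG ↔ IsRegularElt (γ.val : GL (Fin 3) (UnitaryGroup.LocalRing L v)) ∧ γ ∉ hyperbolicSet L v)
    (hopen' : IsOpen {g : Gqs L v | IsRegularElt (g.val : GL (Fin 3) (UnitaryGroup.LocalRing L v)) ∧ g ∉ hyperbolicSet L v})
    (hM1 : ∀ π : IrrClass (Gqs L v), Measurable (𝔇.char π) ∧ LocallyIntegrable (𝔇.char π) 𝔇.μG ∧
      (∀ x ∈ 𝔇.regG, ∀ᶠ y in 𝓝 x, 𝔇.char π y = 𝔇.char π x) ∧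
      ∀ φ : Gqs L v → ℂ, IsLocSmooth φ → π.smoothTrace 𝔇.μG φ = ∫ x, φ x * 𝔇.char π x ∂𝔇.μG)
    (hWIF : 𝔇.WeylIntegrationFormula) (hC1 : 𝔇.EllCartanSubset) (hC2 : 𝔇.EllCartanAE) (hC3 : 𝔇.NonEllCartanAE) (hL2 : 𝔇.L2CharOnTorusAll)
    (par : IrrClass (Gqs L v) → (((UnitaryGroup.LocalRing L v)ˣ →* ℂˣ) × (↥(normOneUnits (conjLocal L (IsCMField.complexConj L) v)) →* ℂˣ)))
    (hPS2 : ∀ π σ : IrrClass (Gqs L v), ¬ 𝔇.IsL2 π → 𝔇.IsL2 σ → 𝔇.IsEllipticPair π σ → ∀ f : Gqs L v → ℂ, IsLocSmooth f →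
        π.smoothTrace νQv f + σ.smoothTrace νQv f = Representation.smoothTrace (G := Gqs L v) (UnitaryGroup.cmPrincipalSeries L 3 v (UnitaryGroup.cmTorusCharPair L v (par π).1 (par π).2)) νQv f)
    (hNP : ∀ π : IrrClass (Gqs L v), ¬ 𝔇.IsL2 π →
        π.IsConstituentOf (UnitaryGroup.cmPrincipalSeries L 3 v (UnitaryGroup.cmTorusCharPair L v (par π).1 (par π).2)) ∧
          Continuous (par π).1 ∧ Continuous (par π).2)
    {ψ : ↥(Subgroup.center (Gqs L v)) →* ℂˣ} (hψ : Continuous ψ) (detZ : Gqs L v →* ↥(Subgroup.center (Gqs L v)))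
    (hopen : IsOpen (((ψ.comp detZ).ker : Subgroup (Gqs L v)) : Set (Gqs L v)))
    (hdet : 𝔇.detG ψ = IrrClass.mk (SmoothIrrep.ofChar (ψ.comp detZ) hopen))
    (hDet : ¬ 𝔇.IsL2 (𝔇.detG ψ)) (hSt : 𝔇.IsL2 (𝔇.stG ψ)) :
    (∃ f : Gqs L v → ℂ, 𝔇.IsPseudoCoeff (𝔇.detG ψ) f) ∧
      (∃ f : Gqs L v → ℂ, 𝔇.IsPseudoCoeff (𝔇.stG ψ) f ∧ 0 < (f 1).re ∧ (f 1).im = 0) ∧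
      𝔇.innerG (𝔇.char (𝔇.stG ψ)) (𝔇.char (𝔇.stG ψ)) = 1 :=
  epFamily_letters_of_epFunction_of_PS2 L v hns νQv hcanQ 𝔇 hμG horb hreg hE hopen' hM1 hWIF hC1 hC2 hC3 hL2
    (F0P3cStCharTSEPGlueGRamified.exists_epFunction_G_of_ramified L v hns w he h2w νQv hcanQ) par hPS2 hNP hψ detZ hopen hdet hDet hSt

end Datum

end Summit.HodgeConjecture.HodgeConjecture.Cruxes.H413.F0P3cStCharTSEPPseudoCoeffStUnr

end
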